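import Mathlib

/-!
# PneNP / OverlapGapAlgebra — crux `SolvableImpliesStableSection` (stmt-PneNP-2463):
# the MONOTONE REPAIR block (13/·) — reversing and concatenating clause-walks

Support for crux `stmt-PneNP-2463` (`Summit.PneNP.PneNP.Theses.OverlapGapAlgebra.SolvableImpliesStableSection`):
the f-free block "bounded-round monotone repair gives stable sections up to `α ≤ 2^k/(4k)`".
Clause-walks up a witness tree (`…MonotoneRepairTreeWalks`) have positive in-slots and negative
out-slots.  To walk from the root DOWN to a node one reverses such a walk (in-slots negative,
out-slots positive), and to close a walk through two branches one concatenates a down-walk, one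
ACROSS step (two positive slots of distinct clauses sharing a variable) and an up-walk.  This file does
the index bookkeeping, with the sign facts that make in- and out-slots differ:

* `sissR_walk_rev` — the reversal of an up-type walk, with a prescribed (positive) final out-slot;
* `sissR_walk_concat` — down-type walk + across step + up-type walk: a clause-walk with in-slot `≠`
  out-slot at every inner clause and distinct slots at consecutive equal clauses.
Pure combinatorics; no definitions; axioms `propext`, `Classical.choice`, `Quot.sound`.
-/

set_option linter.dupNamespace false -- `Summit.PneNP.PneNP.…`: summit = sub-problem (D-0017)

namespace Summit.PneNP.PneNP.Theorems

open Finset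
open scoped Classical

section WalkOps

variable {m k n : ℕ}

/-- **Reversal of an up-type walk.** Given a clause-walk `w, u, o` of length `P` with positive
in-slots and negative out-slots, and a positive slot `j₁` of `w 0`, the reversed walk `W i = w (P - i)`
(in-slots `o`, out-slots `u`, final out-slot `j₁`) is a clause-walk of length `P` from `w P` to `w 0`
with negative in-slots and positive out-slots (the last one being `j₁`). -/
theorem sissR_walk_rev (Φ : (Fin m → Fin k → Fin n × Bool)) (P : ℕ) (w : ℕ → Fin m) (u o : ℕ → Fin k)
    (hsteps : ∀ d, d < P → (Φ (w (d + 1)) (u (d + 1))).1 = (Φ (w d) (o d)).1)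
    (hin : ∀ i, 1 ≤ i → i ≤ P → (Φ (w i) (u i)).2 = true)
    (hout : ∀ d, d < P → (Φ (w d) (o d)).2 = false)
    (j₁ : Fin k) (hj₁ : (Φ (w 0) j₁).2 = true) :
    ∃ (W : ℕ → Fin m) (U O : ℕ → Fin k), W 0 = w P ∧ W P = w 0 ∧ O P = j₁ ∧
      (∀ d, d < P → (Φ (W (d + 1)) (U (d + 1))).1 = (Φ (W d) (O d)).1) ∧
      (∀ i, 1 ≤ i → i ≤ P → (Φ (W i) (U i)).2 = false) ∧
      (∀ d, d ≤ P → (Φ (W d) (O d)).2 = true) := by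
  refine ⟨fun i => w (P - i), fun i => o (P - i), fun i => if i = P then j₁ else u (P - i),
    by simp, by simp, by simp, ?_, ?_, ?_⟩
  · intro d hd
    have hdP : d ≠ P := by omega
    simp only [hdP, if_false]
    have h1 : P - d = P - (d + 1) + 1 := by omega
    have := hsteps (P - (d + 1)) (by omega)
    rw [← h1] at this
    exact this.symm
  · intro i h1 h2
    exact hout (P - i) (by omega)
  · intro d hd
    by_cases hdP : d = P
    · subst hdP
      simp only [if_true, Nat.sub_self]
      exact hj₁
    · simp only [hdP, if_false]
      exact hin (P - d) (by omega) (by omega)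

/-- **Concatenation: down, across, up.** Let `W₁, U₁, O₁` be a clause-walk of length `P₁` with
negative in-slots and positive out-slots (including a final out-slot `O₁ P₁`), and `w₂, u₂, o₂` a
clause-walk of length `P₂` with positive in-slots and negative out-slots; let `j₂` be a positive slot
of `w₂ 0` with `var(w₂ 0, j₂) = var(W₁ P₁, O₁ P₁)` and `W₁ P₁ ≠ w₂ 0`. Then the concatenated sequence is
a clause-walk of length `P₁ + 1 + P₂` from `W₁ 0` to `w₂ P₂` whose in- and out-slot differ at every
inner clause and which uses different slots at consecutive equal clauses. -/
theorem sissR_walk_concat (Φ : (Fin m → Fin k → Fin n × Bool)) (P₁ : ℕ) (W₁ : ℕ → Fin m) (U₁ O₁ : ℕ → Fin k)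
    (hsteps₁ : ∀ d, d < P₁ → (Φ (W₁ (d + 1)) (U₁ (d + 1))).1 = (Φ (W₁ d) (O₁ d)).1)
    (hin₁ : ∀ i, 1 ≤ i → i ≤ P₁ → (Φ (W₁ i) (U₁ i)).2 = false)
    (hout₁ : ∀ d, d ≤ P₁ → (Φ (W₁ d) (O₁ d)).2 = true)
    (P₂ : ℕ) (w₂ : ℕ → Fin m) (u₂ o₂ : ℕ → Fin k)
    (hsteps₂ : ∀ d, d < P₂ → (Φ (w₂ (d + 1)) (u₂ (d + 1))).1 = (Φ (w₂ d) (o₂ d)).1)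
    (hin₂ : ∀ i, 1 ≤ i → i ≤ P₂ → (Φ (w₂ i) (u₂ i)).2 = true)
    (hout₂ : ∀ d, d < P₂ → (Φ (w₂ d) (o₂ d)).2 = false)
    (j₂ : Fin k) (hj₂ : (Φ (w₂ 0) j₂).2 = true)
    (hacross : (Φ (w₂ 0) j₂).1 = (Φ (W₁ P₁) (O₁ P₁)).1) (hne : W₁ P₁ ≠ w₂ 0) :
    ∃ (W : ℕ → Fin m) (U O : ℕ → Fin k), W 0 = W₁ 0 ∧ W (P₁ + 1 + P₂) = w₂ P₂ ∧
      (∀ d, d < P₁ + 1 + P₂ → (Φ (W (d + 1)) (U (d + 1))).1 = (Φ (W d) (O d)).1) ∧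
      (∀ i, 1 ≤ i → i ≤ P₁ + P₂ → U i ≠ O i) ∧
      (∀ d, d < P₁ + 1 + P₂ → W (d + 1) = W d → U (d + 1) ≠ O d) := by
  set W : ℕ → Fin m := fun i => if i ≤ P₁ then W₁ i else w₂ (i - (P₁ + 1)) with hW
  set U : ℕ → Fin k := fun i => if i ≤ P₁ then U₁ i else if i = P₁ + 1 then j₂ else u₂ (i - (P₁ + 1))
    with hU
  set O : ℕ → Fin k := fun i => if i ≤ P₁ then O₁ i else o₂ (i - (P₁ + 1)) with hO
  -- the sign of every in-slot and out-slot
  have hinF : ∀ i, 1 ≤ i → i ≤ P₁ → (Φ (W i) (U i)).2 = false := by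
    intro i h1 h2
    simp only [hW, hU, h2, if_true]
    exact hin₁ i h1 h2
  have hinT : ∀ i, P₁ + 1 ≤ i → i ≤ P₁ + 1 + P₂ → (Φ (W i) (U i)).2 = true := by
    intro i h1 h2
    have hi : ¬ i ≤ P₁ := by omega
    by_cases hi1 : i = P₁ + 1
    · subst hi1
      have h' : ¬ P₁ + 1 ≤ P₁ := by omega
      simp only [hW, hU, h', if_false, if_true, Nat.sub_self]
      exact hj₂
    · simp only [hW, hU, hi, hi1, if_false]
      exact hin₂ (i - (P₁ + 1)) (by omega) (by omega)
  have houtT : ∀ d, d ≤ P₁ → (Φ (W d) (O d)).2 = true := by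
    intro d hd
    simp only [hW, hO, hd, if_true]
    exact hout₁ d hd
  have houtF : ∀ d, P₁ + 1 ≤ d → d < P₁ + 1 + P₂ → (Φ (W d) (O d)).2 = false := by
    intro d h1 h2
    have hd : ¬ d ≤ P₁ := by omega
    simp only [hW, hO, hd, if_false]
    exact hout₂ (d - (P₁ + 1)) (by omega)
  refine ⟨W, U, O, by simp [hW], ?_, ?_, ?_, ?_⟩
  · have h : ¬ P₁ + 1 + P₂ ≤ P₁ := by omega
    simp only [hW, h, if_false]
    congr 1
    omega
  · -- the step equations
    intro d hd
    rcases Nat.lt_trichotomy d P₁ with h | h | h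
    · have h1 : d ≤ P₁ := h.le
      have h2 : d + 1 ≤ P₁ := h
      simp only [hW, hU, hO, h1, h2, if_true]
      exact hsteps₁ d h
    · subst h
      have h1 : ¬ d + 1 ≤ d := by omega
      simp only [hW, hU, hO, h1, if_false, le_refl, if_true, Nat.sub_self]
      exact hacross
    · have h1 : ¬ d ≤ P₁ := by omega
      have h2 : ¬ d + 1 ≤ P₁ := by omega
      have h3 : d + 1 ≠ P₁ + 1 := by omega
      simp only [hW, hU, hO, h1, h2, h3, if_false]
      have h4 : d + 1 - (P₁ + 1) = d - (P₁ + 1) + 1 := by omega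
      rw [h4]
      exact hsteps₂ (d - (P₁ + 1)) (by omega)
  · -- in-slot ≠ out-slot at the inner clauses
    intro i h1 h2 hcon
    rcases Nat.lt_or_ge i (P₁ + 1) with h | h
    · have ha := hinF i h1 (by omega)
      have hb := houtT i (by omega)
      rw [hcon] at ha
      rw [ha] at hb
      exact absurd hb (by simp)
    · have ha := hinT i h (by omega)
      have hb := houtF i h (by omega)
      rw [hcon] at ha
      rw [ha] at hb
      exact absurd hb (by simp)
  · -- consecutive equal clauses use different slots
    intro d hd hWW hcon
    rcases Nat.lt_trichotomy d P₁ with h | h | h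
    · have ha := hinF (d + 1) (by omega) (by omega)
      have hb := houtT d h.le
      rw [hWW, hcon] at ha
      rw [ha] at hb
      exact absurd hb (by simp)
    · subst h
      have h1 : ¬ d + 1 ≤ d := by omega
      simp only [hW, h1, if_false, le_refl, if_true, Nat.sub_self] at hWW
      exact hne hWW.symm
    · have ha := hinT (d + 1) (by omega) (by omega)
      have hb := houtF d (by omega) hd
      rw [hWW, hcon] at ha
      rw [ha] at hb
      exact absurd hb (by simp)

end WalkOps

end Summit.PneNP.PneNP.Theorems
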